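import Summits.Ventures.CertifiedManyBodySolver.Observables.CanonicalCeilingW32K4o7SourcedRowG6o7
import Summits.Ventures.CertifiedManyBodySolver.Observables.CanonicalCeilingA0W32K4o7SourcedRows
import HarnessLib

/-!
# CEILING SLOTS 4 — typed ceilings for the four NEW floor fields of FLOOR-TABLE SLOTS 5 that had none: t′ = 0 @ h_tree 0.36770 / 0.39598 (xh line vs row 6/7) and A0 @ 0.26163 / 0.32527 (A0 b0 line vs row 5/7), so those cells are born TWO-SIDED

Cell hubbard-cq (rung CQ, CQ-TABLE canonical `t′ = 0` / A0 columns, CEILING side; row «h-chord transport nodes», seat hubbard-cq-obsth-2 g23, 2026-08-29), on the lead's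
WAKE `wake/WAKE-hubbard-cq-obsth-2-20260829T0548Z.md` follow-through (same rule as ADDENDUM 1 / anomaly-1 g32 ★ RESULT #2 `g32/ceil/ceil_census30.py`: a floor cell of record inside an
eligible landed ceiling continuum's range, below the kinematic scale √2 (RULING 428), gets its typed 7-dp-UP ceiling instance). FLOOR-TABLE SLOTS 5 (p705297,
`CanonicalFloorTwoW5FloorTableSlots5.lean`) adds the t′0 fields g = 13/50, 7/25 and the A0 fields g = 37/200, 23/100 to the columns; the census grid (glance fields only) could not list
them, and no ceiling instance existed there (t′0 69/400 ↦ 0.9056352, 23/100 ↦ 0.9393045 and A0 3/16 ↦ 0.9220138 are already typed). Companion of floor eng-1's `CanonicalCeilingW32K4o7SourcedRowG6o7Slots2.lean` / `CanonicalCeilingA0W32K4o7SourcedRowsSlots.lean` (same parents, same premises, same slot rule;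
separate small module). Parents BY NAME: `canonicalCeiling_n7o8_tp0_W32k4o7xh_of_row_g6o7` (p673017; `0 < g ≤ 2/7`) of `CanonicalCeilingW32K4o7SourcedRowG6o7.lean` and
`canonicalCeilingA0_n7o8_tpm1o4_A0W32k4o7b0_of_row_g5o7` (`0 < g ≤ 2/7`) of `CanonicalCeilingA0W32K4o7SourcedRows.lean`. No new continuum, no new node, zero compute:

* `canonicalCeiling_n7o8_tp0_W32k4o7xh_decimal_g13o50_r6o7` — g = 13/50 (h_tree ≈ 0.36770): **≤ 0.9594451** (x ∈ (0.9594450193, 0.9594450194); numerator (A + B·g) − E = +1.620478704; t′0 floor 0.2066279 @ 0.36770 = SLOTS5 `canonicalFloor_n7o8_tp0_W32twoW5k4o7_decimal_g13o50` (p705297; NEW field once booked) — no ceiling typed at this field before)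
* `canonicalCeiling_n7o8_tp0_W32k4o7xh_decimal_g7o25_r6o7` — g = 7/25 (h_tree ≈ 0.39598): **≤ 0.9740354** (x ∈ (0.9740353247, 0.9740353247); numerator (A + B·g) − E = +1.590021607; t′0 floor 0.2334604 @ 0.39598 = SLOTS5 `canonicalFloor_n7o8_tp0_W32twoW5k4o7_decimal_g7o25` (p705297; NEW field once booked) — no ceiling typed at this field before)
* `canonicalCeilingA0_n7o8_tpm1o4_A0W32k4o7b0_decimal_g37o200_r5o7` — g = 37/200 (h_tree ≈ 0.26163): **≤ 0.9202019** (x ∈ (0.9202018990, 0.9202018990); numerator (A + B·g) − E = +1.377584637; A0 floor 0.0048773 @ 0.26163 = SLOTS5 `canonicalFloorA0_n7o8_A0twoW5k3o7_decimal_g37o200` (p705297; NEW A0 field once booked; R5-GATED 0.0091342 behind it) — no ceiling typed at this field before)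
* `canonicalCeilingA0_n7o8_tpm1o4_A0W32k4o7b0_decimal_g23o100_r5o7` — g = 23/100 (h_tree ≈ 0.32527): **≤ 0.9556781** (x ∈ (0.9556780915, 0.9556780915); numerator (A + B·g) − E = +1.309056169; A0 floor 0.1056773 @ 0.32527 = SLOTS5 `canonicalFloorA0_n7o8_A0twoW5k3o7_decimal_g23o100` (p705297; NEW A0 field once booked; R5-GATED 0.1093390 behind it) — no ceiling typed at this field before)

Words = `⌈10⁷·x⌉/10⁷`, `x = ((A + B·g) − E)/(2·√2·(g₂ − g))` with the parents' typed ℚ literals PARSED FROM THE TREE, at BOTH ends `√2 ∈ (1.4142135623, 1.4142135624)` (asserted equal;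
generator g23/gen_ceil3.py, stdlib `Fraction`; calibration: `canonicalCeiling_n7o8_tp0_W32k4o7xh_decimal_g3o16_r6o7` ↦ 0.9138611 reproduced; `canonicalCeilingA0_n7o8_tpm1o4_A0W32k4o7b0_decimal_g3o16_r5o7` ↦ 0.9220138 reproduced; no prior reading of these four fields exists (anomaly-1's `ceil_instances_check.py` tripwire replays landed ceiling literals by value)), certified in Lean through the slot rule
`chord_le_of_decimal_bound_s4` (re-declared privately, verbatim the parents' private rule; all four words 7-dp TIGHT: `M − 10⁻⁷` violates the side condition).

SIZE, STATED PLAINLY: kinematic scale (≈ 0.96 / 0.98 and 0.91 / 0.94 against floors ≈ 0.21 / 0.23 and 0.005 / 0.11; all < √2 = the certificate-free kinematic bound, RULING 428); CONSISTENT WITH ANY RESPONSE SHAPE below that scale, `m ≤ C·h` included. HONEST FRAMING: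
finite-field RESPONSE ceilings at large pairing fields (h_p = 4·h_tree) on infinite-volume ground states at fixed density ⅞, CONDITIONAL by name on the κ 4/7 two-field(-diag-hop)
node (W5-CERTIFIED), the x2dk head cap node (refereed) and the anchoring energy rows (S1 dual certificate replayed / A0 sourced row as typed); a ceiling never speaks to presence;
nothing about `h → 0`; never onset, gap, `T_c` or order; superconductivity in the Hubbard model is NOT proved or disproved by any of this. No definition; no named fact; no `sorry`.
References: R. B. Griffiths, Phys. Rev. 152 (1966) 240 §II; T. Koma, H. Tasaki, J. Stat. Phys. 76 (1994) 745 §1.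
-/

noncomputable section

namespace Summit.Ventures.CertifiedManyBodySolver.Observables

open Matrix Finset Literature.Probability.LatticeModels
open Literature.MathematicalPhysics.QuantumLattice Literature.MathematicalPhysics.QuantumLattice.ThermodynamicLimit
open Literature.MathematicalPhysics.QuantumLattice.TwoCluster InfVolFermionState
open Summit.Ventures.CertifiedManyBodySolver Summit.Ventures.CertifiedManyBodySolver.Certificates
open scoped ComplexOrder

section CeilSlots4

variable {ω : InfVolFermionState 2}

/-- `1.4142135623 < √2`. [folklore] -/
private theorem sqrt_two_gt_14142135623_s4 : (14142135623 / 10 ^ 10 : ℝ) < Real.sqrt 2 := by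
  rw [Real.lt_sqrt (by norm_num)]; norm_num

/-- Slot rule for a ceiling (verbatim the parents' private rule): from `x ≤ N/(2(√2·g₂ − √2·g))` with `g < g₂`, `0 ≤ N` and the decidable side
condition `N·10¹⁰ ≤ M·2·14142135623·(g₂ − g)` conclude `x ≤ M`. [folklore] -/
private theorem chord_le_of_decimal_bound_s4 {x N g g₂ M : ℝ} (hgg : g < g₂) (hN : 0 ≤ N)
    (hside : N * 10 ^ 10 ≤ M * (2 * 14142135623 * (g₂ - g))) (hx : x ≤ N / (2 * (Real.sqrt 2 * g₂ - Real.sqrt 2 * g))) : x ≤ M := by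
  have hs := sqrt_two_gt_14142135623_s4
  have hδ : 0 < g₂ - g := sub_pos.2 hgg
  have hden : 0 < 2 * (Real.sqrt 2 * g₂ - Real.sqrt 2 * g) := by
    have : Real.sqrt 2 * g₂ - Real.sqrt 2 * g = Real.sqrt 2 * (g₂ - g) := by ring
    rw [this]; positivity
  refine hx.trans ?_
  rw [div_le_iff₀ hden]
  have hM : 0 ≤ M := by
    by_contra hM'
    have : M * (2 * 14142135623 * (g₂ - g)) < 0 := mul_neg_of_neg_of_pos (not_le.mp hM') (by positivity)
    nlinarith
  nlinarith [mul_le_mul_of_nonneg_left hs.le (by positivity : (0:ℝ) ≤ M * (2 * (g₂ - g)))]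

/-- **Ceiling slot at `g = 13/50` (`h_tree ≈ 0.36770`), t′ = 0, xh line (κ 4/7 two-field node `cert_sgf_openbox32x4_U8_mu7o4_k4o7_j264563_twoField` read DOWN from g₀ = 2/7 ⊕ x2dk `cert_capTPx2dk_4x3_U8_tpm1o4_g3o14_mu5o2`) vs the FLOOR cell's S1 row E15 @ g₂ = 6/7 (`cert_pin1menuA0p_L3h0_U8_tp0_g6o7_E_j313009`): `Re ω(P₀^d) ≤ 0.9594451`** for every
translation-invariant density-`7/8` minimiser of `E_{√2·13/50}` (exact chord `0.9594450194…`, 7 dp UP, decidable through `1.4142135623 < √2`; t′0 floor 0.2066279 @ 0.36770 = SLOTS5 `canonicalFloor_n7o8_tp0_W32twoW5k4o7_decimal_g13o50` (p705297; NEW field once booked) — no ceiling typed at this field before).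
Instance of `canonicalCeiling_n7o8_tp0_W32k4o7xh_of_row_g6o7`. CONDITIONAL by name on `cert_sgf_openbox32x4_U8_mu7o4_k4o7_j264563_twoField` + `cert_capTPx2dk_4x3_U8_tpm1o4_g3o14_mu5o2` + `cert_pin1menuA0p_L3h0_U8_tp0_g6o7_E_j313009`. Kinematic scale; a ceiling never speaks to presence. [cite: Griffiths1966, §II] -/
theorem canonicalCeiling_n7o8_tp0_W32k4o7xh_decimal_g13o50_r6o7 (hω : ω.IsTranslationInvariant) (hρ : ω.density = 7 / 8)
    (hmin : ∀ ω' : InfVolFermionState 2, ω'.IsTranslationInvariant → ω'.density = 7 / 8 →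
      ω.meanEnergy (hubbardTTPrimeSourcedInteraction 1 0 8 0 dWaveFormFactor (Real.sqrt 2 * (13 / 50 : ℝ))) 1 ≤
        ω'.meanEnergy (hubbardTTPrimeSourcedInteraction 1 0 8 0 dWaveFormFactor (Real.sqrt 2 * (13 / 50 : ℝ))) 1)
    (hW : cert_sgf_openbox32x4_U8_mu7o4_k4o7_j264563_twoField) (hC : cert_capTPx2dk_4x3_U8_tpm1o4_g3o14_mu5o2) (hN : cert_pin1menuA0p_L3h0_U8_tp0_g6o7_E_j313009) :
    (ω.expect (pairRegion (insert (0 : Site 2) unitSteps) 0) (localPairAt (insert 0 unitSteps) dWaveFormFactor 0)).re ≤ (9594451 / 10000000 : ℝ) :=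
  chord_le_of_decimal_bound_s4 (by norm_num) (by push_cast; norm_num) (by push_cast; norm_num)
    (canonicalCeiling_n7o8_tp0_W32k4o7xh_of_row_g6o7 (13 / 50 : ℝ) (by norm_num) (by norm_num) hω hρ hmin hW hC hN)

/-- **Ceiling slot at `g = 7/25` (`h_tree ≈ 0.39598`), t′ = 0, xh line (κ 4/7 two-field node `cert_sgf_openbox32x4_U8_mu7o4_k4o7_j264563_twoField` read DOWN from g₀ = 2/7 ⊕ x2dk `cert_capTPx2dk_4x3_U8_tpm1o4_g3o14_mu5o2`) vs the FLOOR cell's S1 row E15 @ g₂ = 6/7 (`cert_pin1menuA0p_L3h0_U8_tp0_g6o7_E_j313009`): `Re ω(P₀^d) ≤ 0.9740354`** for every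
translation-invariant density-`7/8` minimiser of `E_{√2·7/25}` (exact chord `0.9740353247…`, 7 dp UP, decidable through `1.4142135623 < √2`; t′0 floor 0.2334604 @ 0.39598 = SLOTS5 `canonicalFloor_n7o8_tp0_W32twoW5k4o7_decimal_g7o25` (p705297; NEW field once booked) — no ceiling typed at this field before).
Instance of `canonicalCeiling_n7o8_tp0_W32k4o7xh_of_row_g6o7`. CONDITIONAL by name on `cert_sgf_openbox32x4_U8_mu7o4_k4o7_j264563_twoField` + `cert_capTPx2dk_4x3_U8_tpm1o4_g3o14_mu5o2` + `cert_pin1menuA0p_L3h0_U8_tp0_g6o7_E_j313009`. Kinematic scale; a ceiling never speaks to presence. [cite: Griffiths1966, §II] -/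
theorem canonicalCeiling_n7o8_tp0_W32k4o7xh_decimal_g7o25_r6o7 (hω : ω.IsTranslationInvariant) (hρ : ω.density = 7 / 8)
    (hmin : ∀ ω' : InfVolFermionState 2, ω'.IsTranslationInvariant → ω'.density = 7 / 8 →
      ω.meanEnergy (hubbardTTPrimeSourcedInteraction 1 0 8 0 dWaveFormFactor (Real.sqrt 2 * (7 / 25 : ℝ))) 1 ≤
        ω'.meanEnergy (hubbardTTPrimeSourcedInteraction 1 0 8 0 dWaveFormFactor (Real.sqrt 2 * (7 / 25 : ℝ))) 1)
    (hW : cert_sgf_openbox32x4_U8_mu7o4_k4o7_j264563_twoField) (hC : cert_capTPx2dk_4x3_U8_tpm1o4_g3o14_mu5o2) (hN : cert_pin1menuA0p_L3h0_U8_tp0_g6o7_E_j313009) :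
    (ω.expect (pairRegion (insert (0 : Site 2) unitSteps) 0) (localPairAt (insert 0 unitSteps) dWaveFormFactor 0)).re ≤ (9740354 / 10000000 : ℝ) :=
  chord_le_of_decimal_bound_s4 (by norm_num) (by push_cast; norm_num) (by push_cast; norm_num)
    (canonicalCeiling_n7o8_tp0_W32k4o7xh_of_row_g6o7 (7 / 25 : ℝ) (by norm_num) (by norm_num) hω hρ hmin hW hC hN)

/-- **Ceiling slot at `g = 37/200` (`h_tree ≈ 0.26163`), A0 t′ = −1/4, A0 b0 line (κ 4/7 diag-hop node `cert_sgf_openbox32x4_U8_mu7o4_k4o7_j264563_twoFieldDiagHop` read DOWN from g₀ = 2/7 ⊕ x2dk `cert_capTPx2dk_4x3_U8_tpm1o4_g3o14_mu5o2`) vs the A0 sourced row E(g₂) @ g₂ = 5/7 (`cert_pin2menuA0_L3_U8_tpm1o4_g5o7_E_plain_j287829`): `Re ω(P₀^d) ≤ 0.9202019`** for every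
translation-invariant density-`7/8` minimiser of `E^{−1/4}_{√2·37/200}` (exact chord `0.9202018990…`, 7 dp UP, decidable through `1.4142135623 < √2`; A0 floor 0.0048773 @ 0.26163 = SLOTS5 `canonicalFloorA0_n7o8_A0twoW5k3o7_decimal_g37o200` (p705297; NEW A0 field once booked; R5-GATED 0.0091342 behind it) — no ceiling typed at this field before).
Instance of `canonicalCeilingA0_n7o8_tpm1o4_A0W32k4o7b0_of_row_g5o7`. CONDITIONAL by name on `cert_sgf_openbox32x4_U8_mu7o4_k4o7_j264563_twoFieldDiagHop` + `cert_capTPx2dk_4x3_U8_tpm1o4_g3o14_mu5o2` + `cert_pin2menuA0_L3_U8_tpm1o4_g5o7_E_plain_j287829`. Kinematic scale; a ceiling never speaks to presence. [cite: Griffiths1966, §II] -/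
theorem canonicalCeilingA0_n7o8_tpm1o4_A0W32k4o7b0_decimal_g37o200_r5o7 (hω : ω.IsTranslationInvariant) (hρ : ω.density = 7 / 8)
    (hmin : ∀ ω' : InfVolFermionState 2, ω'.IsTranslationInvariant → ω'.density = 7 / 8 →
      ω.meanEnergy (hubbardTTPrimeSourcedInteraction 1 (-1 / 4) 8 0 dWaveFormFactor (Real.sqrt 2 * (37 / 200 : ℝ))) 1 ≤
        ω'.meanEnergy (hubbardTTPrimeSourcedInteraction 1 (-1 / 4) 8 0 dWaveFormFactor (Real.sqrt 2 * (37 / 200 : ℝ))) 1)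
    (hW : cert_sgf_openbox32x4_U8_mu7o4_k4o7_j264563_twoFieldDiagHop) (hC : cert_capTPx2dk_4x3_U8_tpm1o4_g3o14_mu5o2) (hN : cert_pin2menuA0_L3_U8_tpm1o4_g5o7_E_plain_j287829) :
    (ω.expect (pairRegion (insert (0 : Site 2) unitSteps) 0) (localPairAt (insert 0 unitSteps) dWaveFormFactor 0)).re ≤ (9202019 / 10000000 : ℝ) :=
  chord_le_of_decimal_bound_s4 (by norm_num) (by push_cast; norm_num) (by push_cast; norm_num)
    (canonicalCeilingA0_n7o8_tpm1o4_A0W32k4o7b0_of_row_g5o7 (37 / 200 : ℝ) (by norm_num) (by norm_num) hω hρ hmin hW hC hN)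

/-- **Ceiling slot at `g = 23/100` (`h_tree ≈ 0.32527`), A0 t′ = −1/4, A0 b0 line (κ 4/7 diag-hop node `cert_sgf_openbox32x4_U8_mu7o4_k4o7_j264563_twoFieldDiagHop` read DOWN from g₀ = 2/7 ⊕ x2dk `cert_capTPx2dk_4x3_U8_tpm1o4_g3o14_mu5o2`) vs the A0 sourced row E(g₂) @ g₂ = 5/7 (`cert_pin2menuA0_L3_U8_tpm1o4_g5o7_E_plain_j287829`): `Re ω(P₀^d) ≤ 0.9556781`** for every
translation-invariant density-`7/8` minimiser of `E^{−1/4}_{√2·23/100}` (exact chord `0.9556780915…`, 7 dp UP, decidable through `1.4142135623 < √2`; A0 floor 0.1056773 @ 0.32527 = SLOTS5 `canonicalFloorA0_n7o8_A0twoW5k3o7_decimal_g23o100` (p705297; NEW A0 field once booked; R5-GATED 0.1093390 behind it) — no ceiling typed at this field before).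
Instance of `canonicalCeilingA0_n7o8_tpm1o4_A0W32k4o7b0_of_row_g5o7`. CONDITIONAL by name on `cert_sgf_openbox32x4_U8_mu7o4_k4o7_j264563_twoFieldDiagHop` + `cert_capTPx2dk_4x3_U8_tpm1o4_g3o14_mu5o2` + `cert_pin2menuA0_L3_U8_tpm1o4_g5o7_E_plain_j287829`. Kinematic scale; a ceiling never speaks to presence. [cite: Griffiths1966, §II] -/
theorem canonicalCeilingA0_n7o8_tpm1o4_A0W32k4o7b0_decimal_g23o100_r5o7 (hω : ω.IsTranslationInvariant) (hρ : ω.density = 7 / 8)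
    (hmin : ∀ ω' : InfVolFermionState 2, ω'.IsTranslationInvariant → ω'.density = 7 / 8 →
      ω.meanEnergy (hubbardTTPrimeSourcedInteraction 1 (-1 / 4) 8 0 dWaveFormFactor (Real.sqrt 2 * (23 / 100 : ℝ))) 1 ≤
        ω'.meanEnergy (hubbardTTPrimeSourcedInteraction 1 (-1 / 4) 8 0 dWaveFormFactor (Real.sqrt 2 * (23 / 100 : ℝ))) 1)
    (hW : cert_sgf_openbox32x4_U8_mu7o4_k4o7_j264563_twoFieldDiagHop) (hC : cert_capTPx2dk_4x3_U8_tpm1o4_g3o14_mu5o2) (hN : cert_pin2menuA0_L3_U8_tpm1o4_g5o7_E_plain_j287829) :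
    (ω.expect (pairRegion (insert (0 : Site 2) unitSteps) 0) (localPairAt (insert 0 unitSteps) dWaveFormFactor 0)).re ≤ (9556781 / 10000000 : ℝ) :=
  chord_le_of_decimal_bound_s4 (by norm_num) (by push_cast; norm_num) (by push_cast; norm_num)
    (canonicalCeilingA0_n7o8_tpm1o4_A0W32k4o7b0_of_row_g5o7 (23 / 100 : ℝ) (by norm_num) (by norm_num) hω hρ hmin hW hC hN)

end CeilSlots4

end Summit.Ventures.CertifiedManyBodySolver.Observables

end
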